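import Literature.Computability.Complexity.FoldBricks
import Literature.Computability.Complexity.ListBricks
import HarnessLib

/-!
# Fold bricks, polynomial form: `foldCat Q p f ⟨x, u⟩ = f ⟨x, 1⁰⟩ ++ ⋯ ++ f ⟨x, 1^{|u|-1}⟩` in `FP`

Trunk `CplxCore`, toolkit continuing `FoldBricks.lean`. There the counted fold
`acc := op ⟨acc, f ⟨x, 1ⁱ⟩⟩` is put in `FP` for piece functions of LINEAR growth in the context `x`
(`clipF C f` clips to `C (|x| + 1)` symbols). A machine that writes a structured code level by
level (the Kabanets–Impagliazzo reduction, `AlgebraicComplexity/KIReductionBricks*.lean`) folds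
pieces that are themselves folds — a whole level of a circuit, polynomially but not linearly long
in the input. This file provides the polynomial form, through `loopFn_mem_FP_of_poly`
(`IterateFPPoly.lean`):

* `pclipF Q f` — `f` clipped to `Q (|fstF z|)` symbols (`pclipF_eq_self` on short outputs);
* `foldLoop_mem_FP_poly`, `foldLoop_pclipF_mem_FP`, `foldAcc_pclipF` — the fold loop with pieces
  of polynomial growth, and unclipping;
* **`foldCat Q p f`** — the packaged concatenation fold on a pair `⟨x, u⟩`: `|u|` rounds (any
  string `u`; `|u| ≤ p (|x|)` rounds are available), output `ccat (t ↦ f ⟨x, 1ᵗ⟩) |u|`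
  (`foldCat_apply`, exact when the pieces actually folded are within the clip `Q (|x|)`), and
  `foldCat_mem_FP`;
* `dropItemsFn ⟨u, W⟩ = sndF^{|u|} W` (the remainder of a nested-pair list after `|u|` items; the
  inner part of `HashBricks.nthItemFn`), in `FP`;
* `ccat` bookkeeping: `ccat_eq_ccat_of_eq_nil` (trailing empty pieces), `ccat_frame_eq_encList`
  (concatenated frames `⟨a, ε⟩` are the list code `encList`).

Twins: several lemmas here re-prove statements that exist in files sitting ABOVE this toolkit
(`ParsimoniousThreeCNFMachine.lean`, `BosonReductionMachine.lean`, `FarCertMachineCodes.lean`,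
`GridSAWTowersEnumeration.lean`, which import `FoldBricks` and cannot be imported here); each such
docstring names the twin it is meant to supersede.

## References

* S. Arora, B. Barak, *Computational Complexity: A Modern Approach*, CUP 2009, §1.3 (polynomial
  time is closed under composition and polynomially bounded loops), §1.4.1 (clocked loops).
-/

namespace Literature.Computability.Complexity

open _root_.Computability Polynomial OracleCompose HashBricks Plumb

namespace Brick

/-! ### Polynomial clipping -/

/-- `pclipF Q f z = (f z) ↾ Q (|fstF z|)`: the output of `f`, clipped to polynomial size in the
first field of the argument. [folklore] -/
noncomputable def pclipF (Q : Polynomial ℕ) (f : List Bool → List Bool) : List Bool → List Bool :=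
  takeFn ∘ fanoutFn (polyFn Q ∘ fstF) f

/-- Value of `pclipF`. [folklore] -/
theorem pclipF_apply (Q : Polynomial ℕ) (f : List Bool → List Bool) (z : List Bool) :
    pclipF Q f z = (f z).take (Q.eval (fstF z).length) := by
  simp [pclipF]

/-- The linear clip of `FoldBricks.lean` is the polynomial clip at `C (X + 1)`. [folklore] -/
theorem clipF_eq_pclipF (C : ℕ) (f : List Bool → List Bool) : clipF C f = pclipF (Polynomial.C C * (X + 1)) f := rfl

/-- The clipped function has polynomial size in the first field, on every input. [folklore] -/
theorem length_pclipF_le (Q : Polynomial ℕ) (f : List Bool → List Bool) (z : List Bool) :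
    (pclipF Q f z).length ≤ Q.eval (fstF z).length := by
  rw [pclipF_apply]; exact List.length_take_le _ _

/-- **Clipping is the identity on short outputs.** [folklore] -/
theorem pclipF_eq_self {Q : Polynomial ℕ} {f : List Bool → List Bool} {z : List Bool}
    (h : (f z).length ≤ Q.eval (fstF z).length) : pclipF Q f z = f z := by
  rw [pclipF_apply, List.take_of_length_le h]

/-- `pclipF Q f ∈ FP` for `f ∈ FP`. [folklore] -/
theorem pclipF_mem_FP (Q : Polynomial ℕ) {f : List Bool → List Bool} (hf : f ∈ FP) : pclipF Q f ∈ FP :=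
  comp_mem_FP takeFn_mem_FP (fanoutFn_mem_FP (comp_mem_FP (polyFn_mem_FP _) fstF_mem_FP) hf)

/-! ### The fold loop with pieces of polynomial growth -/

/-- **Growth of the fold body, polynomial form** (twins, to supersede: `Ladder3.length_foldBody_le_poly`,
`ParsimoniousThreeCNFMachine.lean`, and `Brick.length_foldBody_le_poly`, `GoldwasserSipserRefereeBricks.lean`,
both above this toolkit): for `op` of additive growth and `f` with
`|f w| ≤ Q (|fstF w|)` on every input, `|foldBody op f z| ≤ |sndPow 1 z| + Q (|fstF z|) + d + 4`. [folklore] -/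
theorem length_foldBody_le_polyQ {op f : List Bool → List Bool} {d : ℕ} {Q : Polynomial ℕ}
    (hop : ∀ w, (op w).length ≤ (fstF w).length + (sndF w).length + d)
    (hf : ∀ w, (f w).length ≤ Q.eval (fstF w).length) (z : List Bool) :
    (foldBody op f z).length ≤ (sndPow 1 z).length + (Q + Polynomial.C (d + 4)).eval (fstF z).length := by
  rw [foldBody, length_fanoutFn]
  have h1 := length_nthF_succ_add_sndPow_succ_le 1 z
  have h2 := hop (fanoutFn (sndPow 2) (f ∘ fanoutFn (nthF 0) (nthF 2)) z)
  have h3 := hf (fanoutFn (nthF 0) (nthF 2) z)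
  simp only [Function.comp_apply, fanoutFn_apply, fstF_boolPair, sndF_boolPair, List.length_cons,
    nthF_zero, eval_add, eval_C, Nat.reduceAdd] at h1 h2 h3 ⊢
  omega

/-- **The fold loop is in `FP`, polynomial form** (twins, to supersede: `Ladder3.foldLoop_mem_FP_poly`,
`ParsimoniousThreeCNFMachine.lean`; `Brick.foldLoop_mem_FP_of_poly`, `GoldwasserSipserRefereeBricks.lean`). [cite: AroraBarak2009, §1.3 (bounded loops), §1.4.1] -/
theorem foldLoop_mem_FP_poly {op f : List Bool → List Bool} {d : ℕ} {Q : Polynomial ℕ} (hop : op ∈ FP)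
    (hopg : ∀ w, (op w).length ≤ (fstF w).length + (sndF w).length + d) (hf : f ∈ FP)
    (hfg : ∀ w, (f w).length ≤ Q.eval (fstF w).length) (p : Polynomial ℕ) : foldLoop op f p ∈ FP :=
  loopFn_mem_FP_of_poly (foldBody_mem_FP hop hf) _ (length_foldBody_le_polyQ hopg hfg) p

/-- The fold loop with a polynomially clipped piece function is in `FP`. [folklore] -/
theorem foldLoop_pclipF_mem_FP {op f : List Bool → List Bool} {d : ℕ} (Q : Polynomial ℕ) (hop : op ∈ FP)
    (hopg : ∀ w, (op w).length ≤ (fstF w).length + (sndF w).length + d) (hf : f ∈ FP) (p : Polynomial ℕ) :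
    foldLoop op (pclipF Q f) p ∈ FP :=
  foldLoop_mem_FP_poly hop hopg (pclipF_mem_FP Q hf) (length_pclipF_le Q f) p

/-- **Unclipping**: if the pieces actually folded are short, the clipped fold is the fold. [folklore] -/
theorem foldAcc_pclipF {op f : List Bool → List Bool} {Q : Polynomial ℕ} {x : List Bool} {i k : ℕ} {acc : List Bool}
    (h : ∀ j, i ≤ j → j < i + k → (f (boolPair x (ones j))).length ≤ Q.eval x.length) :
    foldAcc op (pclipF Q f) x i k acc = foldAcc op f x i k acc :=
  foldAcc_congr fun j hj hj' => pclipF_eq_self (by rw [fstF_boolPair]; exact h j hj hj')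

/-! ### The packaged concatenation fold -/

/-- The loop record of `foldCat`: `⟨x, ⟨bin |u|, ⟨ε, ε⟩⟩⟩` from `⟨x, u⟩` (countdown `|u|`, index
`1⁰`, empty accumulator). [folklore] -/
noncomputable def foldCatInit : List Bool → List Bool :=
  fanoutFn fstF (fanoutFn (lenBinF ∘ sndF) (fun _ => boolPair [] []))

/-- `foldCatInit` on a pair. [folklore] -/
@[simp] theorem foldCatInit_boolPair (x u : List Bool) :
    foldCatInit (boolPair x u) = boolPair x (boolPair (encodeNat u.length) (boolPair [] [])) := by
  simp [foldCatInit]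

/-- `foldCatInit ∈ FP`. [folklore] -/
theorem foldCatInit_mem_FP : foldCatInit ∈ FP :=
  fanoutFn_mem_FP fstF_mem_FP (fanoutFn_mem_FP (comp_mem_FP lenBinF_mem_FP sndF_mem_FP) (const_mem_FP _))

/-- **`foldCat Q p f`**: on `⟨x, u⟩`, concatenate the pieces `f ⟨x, 1⁰⟩, …, f ⟨x, 1^{|u|-1}⟩`
(each clipped to `Q (|x|)` symbols; `p (|x|)` rounds available). [cite: AroraBarak2009, §1.3 (bounded loops)] -/
noncomputable def foldCat (Q p : Polynomial ℕ) (f : List Bool → List Bool) : List Bool → List Bool :=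
  sndPow 2 ∘ foldLoop appF (pclipF Q f) p ∘ foldCatInit

/-- **`foldCat Q p f ∈ FP`** for `f ∈ FP`. [cite: AroraBarak2009, §1.3 (bounded loops), §1.4.1] -/
theorem foldCat_mem_FP (Q p : Polynomial ℕ) {f : List Bool → List Bool} (hf : f ∈ FP) : foldCat Q p f ∈ FP :=
  comp_mem_FP (sndPow_mem_FP 2)
    (comp_mem_FP (foldLoop_pclipF_mem_FP Q appF_mem_FP length_appF_le hf p) foldCatInit_mem_FP)

/-- **Semantics of `foldCat`**: with `|u| ≤ p (|x|)` rounds available and the folded pieces within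
the clip, `foldCat Q p f ⟨x, u⟩ = ccat (t ↦ f ⟨x, 1ᵗ⟩) |u|`. [folklore] -/
theorem foldCat_apply {Q p : Polynomial ℕ} {f : List Bool → List Bool} {x u : List Bool}
    (hk : u.length ≤ p.eval x.length) (hQ : ∀ t, t < u.length → (f (boolPair x (ones t))).length ≤ Q.eval x.length) :
    foldCat Q p f (boolPair x u) = ccat (fun t => f (boolPair x (ones t))) u.length := by
  rw [foldCat, Function.comp_apply, Function.comp_apply, foldCatInit_boolPair,
    show boolPair ([] : List Bool) [] = boolPair (ones 0) [] from rfl, foldLoop_apply _ _ hk,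
    foldAcc_pclipF (fun j _ hj => hQ j (by omega)), foldAcc_appF]
  simp

/-! ### Remainders of nested-pair lists -/

/-- **`dropItemsFn ⟨u, W⟩ = sndF^{|u|} W`**: the remainder of a nested-pair list after `|u|`
items (the inner part of `nthItemFn`). [folklore] -/
noncomputable def dropItemsFn : List Bool → List Bool :=
  sndF ∘ fun z => dropItemStep^[X.eval (boolUnpair z).1.length] z

/-- `nthItemFn` is the head item after dropping. [folklore] -/
theorem nthItemFn_eq_fstF_comp_dropItemsFn : nthItemFn = fstF ∘ dropItemsFn := rfl

/-- Value of `dropItemsFn` on a pair. [folklore] -/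
@[simp] theorem dropItemsFn_boolPair (u W : List Bool) : dropItemsFn (boolPair u W) = sndF^[u.length] W := by
  simp only [dropItemsFn, Function.comp_apply, boolUnpair_boolPair, eval_X, iterate_dropItemStep, sndF_boolPair]

/-- `dropItemsFn ∈ FP`. [folklore] -/
theorem dropItemsFn_mem_FP : dropItemsFn ∈ FP :=
  comp_mem_FP sndF_mem_FP (iterate_mem_FP dropItemStep_mem_FP 2 length_dropItemStep_le X)

/-! ### `ccat` bookkeeping -/

/-- Trailing empty pieces do not change a concatenation (generalises `ccat_eq_ccat_of_le`,
`Barriers/CriticalPhenomena/GridSAWTowersEnumeration.lean`). [folklore] -/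
theorem ccat_eq_ccat_of_eq_nil {g : ℕ → List Bool} {m k : ℕ} (hmk : m ≤ k) (h : ∀ t, m ≤ t → t < k → g t = []) :
    ccat g k = ccat g m := by
  induction k with
  | zero => obtain rfl : m = 0 := Nat.le_zero.1 hmk; rfl
  | succ k ih =>
    rcases Nat.lt_or_ge k m with hlt | hge
    · obtain rfl : m = k + 1 := le_antisymm hmk hlt; rfl
    · rw [ccat_succ, h k hge (Nat.lt_succ_self k), List.append_nil, ih hge fun t ht ht' => h t ht (by omega)]

/-- **Concatenated frames are the list code**: `ccat (t ↦ ⟨a t, ε⟩) k = encList [a 0, …, a (k-1)]` (twin, to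
supersede: `ccat_boolPair_nil`, `Algebra/EuclideanLattices/FarCertMachineCodes.lean`). [folklore] -/
theorem ccat_frame_eq_encList (a : ℕ → List Bool) : ∀ k,
    ccat (fun t => boolPair (a t) []) k = encList ((List.range k).map a)
  | 0 => rfl
  | k + 1 => by
    rw [ccat_succ, ccat_frame_eq_encList a k, List.range_succ, List.map_append, List.map_singleton]
    induction (List.range k).map a with
    | nil => rfl
    | cons b l ih => rw [List.cons_append, encList_cons, encList_cons, ← ih]; simp [boolPair, List.append_assoc]

/-- Length of a concatenation with a uniform bound (twin, to supersede: `Ladder3.length_ccat_le_of_lt`,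
`ParsimoniousThreeCNFMachine.lean`; `length_ccat_le'`, `QuantumComplexity/BosonReductionMachine.lean`). [folklore] -/
theorem length_ccat_le' {g : ℕ → List Bool} {b : ℕ} (k : ℕ) (h : ∀ t, t < k → (g t).length ≤ b) : (ccat g k).length ≤ k * b := by
  induction k with
  | zero => simp
  | succ k ih =>
    rw [ccat_succ, List.length_append, Nat.succ_mul]
    have := ih fun t ht => h t (by omega)
    have := h k (Nat.lt_succ_self k)
    omega

end Brick

end Literature.Computability.Complexity
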